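import Mathlib
import HarnessLib
import Literature.Analysis.Calculus.NormConvergentApproximation
import Summits.HubbardSuperconductivity.HubbardSuperconductivity.Theorems.KLProgrammeCooperChannelRiccatiFlowBlock

/-!
# Route `KLProgramme` — DECOMP C2 «ChannelRiccati» in Lean, VI: operator-valued bubble weights
# (C2 (a) with the weight corrections `B'_h`)

Cell gate-hubbard-kl, seat p3; continuation of files I–V (same namespace).  In DECOMP C2 the single-scale Cooper bubble
restricted to the Fermi curve is `P_h = b_h · 1 + B'_h` with `‖B'_h‖ = O(γ^h)` small but NOT zero (the measure
`ds/|∇ε|` makes the leading part a multiple of the identity; kit job j247856 measured `‖B'_h‖/b_h` = 2.7 % / 0.4 % /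
≤ 0.3 % at the first Fermi-surface scales).  The exact single-scale ladder with the operator-valued weight is
`V ↦ V (1 + P_h V)⁻¹ = V (1 + b_h V + B'_h V)⁻¹`; this file compares it with the scalar-weight cascade `V (1 + b_h V)⁻¹` of
files II/IV:

* `inverse_sub_inverse` — the resolvent identity `R_P - R_b = - R_P (B V) R_b` for two-sided inverses `R_b` of `1 + b V`
  and `R_P` of `1 + b V + B V`;
* `norm_inverse_weighted_le_two` — `‖R_P‖ ≤ 2` when `|b| ‖V‖ ≤ 1/4`, `‖B‖ ‖V‖ ≤ 1/4`;
* `norm_mul_inverse_weighted_sub_le` — **`‖V R_P - V R_b‖ ≤ (8/3) ‖B‖ ‖V‖²`**;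
* `abs_formInf_weighted_sub_cascadeStep_le` / `abs_formSup_weighted_sub_cascadeStep_le` — **C2 (a) with weight
  corrections**: `|formInf (V R_P + Q) - cascadeStep b (formInf V)| ≤ (8/3) ‖B‖ ‖V‖² + ‖Q‖` (symmetric `V`), and the same
  for the top of the form — so in the block flow of file IV the anisotropy of the bubble enters the remainder budget `e_k`
  at RELATIVE order `‖V_k‖` (for the `B1g` block `‖V_k‖ = O(U²)`: the «relative O(U²)» of the C2 kill-test reading);
* `exists_inverse_one_add`, `exists_inverse_weighted` — in a COMPLETE space the inverses exist (Neumann series, via the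
  tree's `Literature.Analysis.Calculus.exists_inverse_of_norm_one_sub_lt`), so the inverse equations assumed in files
  II/IV/V are dischargeable from the smallness alone.

References: HOME/DECOMP.md v7 §2 C2 (statement, «why it might fail», kill test (B)), App. E E2 (a); HOME/p3/C2-KILLTEST.md.
-/

noncomputable section

namespace Summit.HubbardSuperconductivity.HubbardSuperconductivity.Theorems.CooperChannelRiccatiFlow

set_option linter.dupNamespace false -- summit = problem name (single-conjunct summit), D-0017

open scoped InnerProductSpace ComplexConjugate
open RCLike ContinuousLinearMap

variable {E : Type*} [NormedAddCommGroup E] [InnerProductSpace ℂ E]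

section Weight

variable {V B Rb RP : E →L[ℂ] E} {b : ℝ}

/-- **Resolvent identity.**  If `R_b` is a right inverse of `1 + b V` and `R_P` a left inverse of `1 + b V + B V`, then
`R_P - R_b = - (R_P * (B * V) * R_b)`. -/
theorem inverse_sub_inverse (hRb : (1 + b • V) * Rb = 1) (hRP : RP * (1 + b • V + B * V) = 1) :
    RP - Rb = -(RP * (B * V) * Rb) := by
  have h1 : RP * (1 + b • V + B * V) * Rb = Rb := by rw [hRP, one_mul]
  have h2 : RP * (1 + b • V) * Rb = RP := by rw [mul_assoc, hRb, mul_one]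
  have h3 : RP * (1 + b • V + B * V) * Rb = RP * (1 + b • V) * Rb + RP * (B * V) * Rb := by
    rw [mul_add, add_mul]
  rw [h1, h2] at h3
  conv_lhs => rw [h3]
  abel

/-- `‖b V + B V‖ ≤ 1/2` when `|b| ‖V‖ ≤ 1/4` and `‖B‖ ‖V‖ ≤ 1/4`. -/
theorem norm_weight_mul_le_half (hb : |b| * ‖V‖ ≤ 1 / 4) (hB : ‖B‖ * ‖V‖ ≤ 1 / 4) :
    ‖b • V + B * V‖ ≤ 1 / 2 := by
  calc ‖b • V + B * V‖ ≤ ‖b • V‖ + ‖B * V‖ := norm_add_le _ _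
    _ ≤ |b| * ‖V‖ + ‖B‖ * ‖V‖ := by
        gcongr
        · rw [norm_smul, Real.norm_eq_abs]
        · exact opNorm_comp_le B V
    _ ≤ 1 / 4 + 1 / 4 := add_le_add hb hB
    _ = 1 / 2 := by norm_num

/-- The weighted inverse has norm `≤ 2`: `(1 + b V + B V) R_P = 1`, `|b| ‖V‖ ≤ 1/4`, `‖B‖ ‖V‖ ≤ 1/4` ⇒ `‖R_P‖ ≤ 2`. -/
theorem norm_inverse_weighted_le_two (hb : |b| * ‖V‖ ≤ 1 / 4) (hB : ‖B‖ * ‖V‖ ≤ 1 / 4)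
    (hRP : (1 + b • V + B * V) * RP = 1) : ‖RP‖ ≤ 2 := by
  have hX := norm_weight_mul_le_half hb hB
  have h := norm_inverse_le (X := b • V + B * V) hX (by norm_num) (by rwa [← add_assoc])
  norm_num at h
  exact h

/-- **The weight correction costs `(8/3) ‖B‖ ‖V‖²`:** for two-sided inverses `R_b` of `1 + b V` and `R_P` of
`1 + b V + B V` with `|b| ‖V‖ ≤ 1/4`, `‖B‖ ‖V‖ ≤ 1/4`: `‖V R_P - V R_b‖ ≤ (8/3) ‖B‖ ‖V‖²`. -/
theorem norm_mul_inverse_weighted_sub_le (hb : |b| * ‖V‖ ≤ 1 / 4) (hB : ‖B‖ * ‖V‖ ≤ 1 / 4)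
    (hRb : (1 + b • V) * Rb = 1) (hRP₁ : (1 + b • V + B * V) * RP = 1) (hRP₂ : RP * (1 + b • V + B * V) = 1) :
    ‖V * RP - V * Rb‖ ≤ 8 / 3 * ‖B‖ * ‖V‖ ^ 2 := by
  have hdiff : V * RP - V * Rb = -(V * RP * (B * V) * Rb) := by
    rw [← mul_sub, inverse_sub_inverse hRb hRP₂, mul_neg, ← mul_assoc, ← mul_assoc]
  have hRPn := norm_inverse_weighted_le_two hb hB hRP₁
  have hRbn := norm_inverse_le_four_thirds hb hRb
  rw [hdiff, norm_neg]
  calc ‖V * RP * (B * V) * Rb‖ ≤ ‖V‖ * ‖RP‖ * (‖B‖ * ‖V‖) * ‖Rb‖ := by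
        refine (opNorm_comp_le _ _).trans ?_
        gcongr
        refine (opNorm_comp_le _ _).trans ?_
        gcongr
        · exact opNorm_comp_le _ _
        · exact opNorm_comp_le _ _
    _ ≤ ‖V‖ * 2 * (‖B‖ * ‖V‖) * (4 / 3) := by gcongr
    _ = 8 / 3 * ‖B‖ * ‖V‖ ^ 2 := by ring

/-- **C2 (a) with weight corrections, bottom of the form.**  For symmetric `V`, a real `b` and a bounded `B` with
`|b| ‖V‖ ≤ 1/4`, `‖B‖ ‖V‖ ≤ 1/4`, two-sided inverses `R_b` of `1 + b V` and `R_P` of `1 + b V + B V`, and any bounded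
remainder `Q`: `|formInf (V R_P + Q) - cascadeStep b (formInf V)| ≤ (8/3) ‖B‖ ‖V‖² + ‖Q‖`. -/
theorem abs_formInf_weighted_sub_cascadeStep_le (hV : (V : E →ₗ[ℂ] E).IsSymmetric) (hb : |b| * ‖V‖ ≤ 1 / 4)
    (hB : ‖B‖ * ‖V‖ ≤ 1 / 4) (hRb₁ : (1 + b • V) * Rb = 1) (hRb₂ : Rb * (1 + b • V) = 1)
    (hRP₁ : (1 + b • V + B * V) * RP = 1) (hRP₂ : RP * (1 + b • V + B * V) = 1) (Q : E →L[ℂ] E) :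
    |formInf (V * RP + Q) - cascadeStep b (formInf V)| ≤ 8 / 3 * ‖B‖ * ‖V‖ ^ 2 + ‖Q‖ := by
  have hsplit : V * RP + Q = V * Rb + ((V * RP - V * Rb) + Q) := by abel
  rw [hsplit]
  refine (abs_formInf_cascade_add_sub_le hV hb hRb₁ hRb₂ _).trans ?_
  exact (norm_add_le _ _).trans (by gcongr; exact norm_mul_inverse_weighted_sub_le hb hB hRb₁ hRP₁ hRP₂)

/-- **C2 (a) with weight corrections, top of the form:** under the same hypotheses
`|formSup (V R_P + Q) - cascadeStep b (formSup V)| ≤ (8/3) ‖B‖ ‖V‖² + ‖Q‖`. -/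
theorem abs_formSup_weighted_sub_cascadeStep_le (hV : (V : E →ₗ[ℂ] E).IsSymmetric) (hb : |b| * ‖V‖ ≤ 1 / 4)
    (hB : ‖B‖ * ‖V‖ ≤ 1 / 4) (hRb₁ : (1 + b • V) * Rb = 1) (hRb₂ : Rb * (1 + b • V) = 1)
    (hRP₁ : (1 + b • V + B * V) * RP = 1) (hRP₂ : RP * (1 + b • V + B * V) = 1) (Q : E →L[ℂ] E) :
    |formSup (V * RP + Q) - cascadeStep b (formSup V)| ≤ 8 / 3 * ‖B‖ * ‖V‖ ^ 2 + ‖Q‖ := by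
  have hsplit : V * RP + Q = V * Rb + ((V * RP - V * Rb) + Q) := by abel
  rw [hsplit]
  have h := abs_formSup_add_sub_le (V * Rb) ((V * RP - V * Rb) + Q)
  rw [formSup_cascade hV hb hRb₁ hRb₂] at h
  refine h.trans ?_
  exact (norm_add_le _ _).trans (by gcongr; exact norm_mul_inverse_weighted_sub_le hb hB hRb₁ hRP₁ hRP₂)

/-- The one-step remainder budget of file IV with an operator-valued weight: if the next block is `V' = V R_P + Q` with
`‖Q‖ ≤ q`, then `‖V' - V R_b‖ ≤ (8/3) ‖B‖ ‖V‖² + q` — the form in which `blockFlow_envelopes` (file IV, hypothesis `hstep`)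
consumes the weight corrections. -/
theorem norm_next_sub_mul_inverse_le {V' Q : E →L[ℂ] E} {q : ℝ} (hb : |b| * ‖V‖ ≤ 1 / 4) (hB : ‖B‖ * ‖V‖ ≤ 1 / 4)
    (hRb : (1 + b • V) * Rb = 1) (hRP₁ : (1 + b • V + B * V) * RP = 1) (hRP₂ : RP * (1 + b • V + B * V) = 1)
    (hV' : V' = V * RP + Q) (hQ : ‖Q‖ ≤ q) : ‖V' - V * Rb‖ ≤ 8 / 3 * ‖B‖ * ‖V‖ ^ 2 + q := by
  rw [hV', show V * RP + Q - V * Rb = (V * RP - V * Rb) + Q by abel]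
  exact (norm_add_le _ _).trans (add_le_add (norm_mul_inverse_weighted_sub_le hb hB hRb hRP₁ hRP₂) hQ)

end Weight

/-! ## Existence of the inverses in a complete space (Neumann series) -/

section Complete

variable [CompleteSpace E]

/-- In a complete space `1 + X` with `‖X‖ < 1` has a two-sided inverse of norm `≤ (1 - ‖X‖)⁻¹` (Neumann series; the tree's
`Literature.Analysis.Calculus.exists_inverse_of_norm_one_sub_lt`). -/
theorem exists_inverse_one_add {X : E →L[ℂ] E} (hX : ‖X‖ < 1) :
    ∃ R : E →L[ℂ] E, (1 + X) * R = 1 ∧ R * (1 + X) = 1 ∧ ‖R‖ ≤ (1 - ‖X‖)⁻¹ := by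
  have h1 : ‖1 - (1 + X)‖ = ‖X‖ := by
    rw [show (1 : E →L[ℂ] E) - (1 + X) = -X by abel, norm_neg]
  have hM : ‖1 - (1 + X)‖ < 1 := by rwa [h1]
  obtain ⟨N, hNM, hMN, hN⟩ := Literature.Analysis.Calculus.exists_inverse_of_norm_one_sub_lt hM
  rw [h1] at hN
  exact ⟨N, hMN, hNM, hN⟩

/-- The scalar-weight inverse exists: `|b| ‖V‖ ≤ 1/4` ⇒ `∃ R_b, (1 + b V) R_b = 1 = R_b (1 + b V)`, `‖R_b‖ ≤ 4/3`. -/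
theorem exists_inverse_smul {V : E →L[ℂ] E} {b : ℝ} (hb : |b| * ‖V‖ ≤ 1 / 4) :
    ∃ R : E →L[ℂ] E, (1 + b • V) * R = 1 ∧ R * (1 + b • V) = 1 ∧ ‖R‖ ≤ 4 / 3 := by
  have hX : ‖b • V‖ ≤ 1 / 4 := by rwa [norm_smul, Real.norm_eq_abs]
  obtain ⟨R, h1, h2, -⟩ := exists_inverse_one_add (X := b • V) (by linarith)
  exact ⟨R, h1, h2, norm_inverse_le_four_thirds hb h1⟩

/-- The operator-weight inverse exists: `|b| ‖V‖ ≤ 1/4`, `‖B‖ ‖V‖ ≤ 1/4` ⇒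
`∃ R_P, (1 + b V + B V) R_P = 1 = R_P (1 + b V + B V)`, `‖R_P‖ ≤ 2`. -/
theorem exists_inverse_weighted {V B : E →L[ℂ] E} {b : ℝ} (hb : |b| * ‖V‖ ≤ 1 / 4) (hB : ‖B‖ * ‖V‖ ≤ 1 / 4) :
    ∃ R : E →L[ℂ] E, (1 + b • V + B * V) * R = 1 ∧ R * (1 + b • V + B * V) = 1 ∧ ‖R‖ ≤ 2 := by
  have hX := norm_weight_mul_le_half hb hB
  obtain ⟨R, h1, h2, -⟩ := exists_inverse_one_add (X := b • V + B * V) (by linarith)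
  rw [← add_assoc] at h1 h2
  exact ⟨R, h1, h2, norm_inverse_weighted_le_two hb hB h1⟩

end Complete

end Summit.HubbardSuperconductivity.HubbardSuperconductivity.Theorems.CooperChannelRiccatiFlow

end
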